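import Mathlib

/-!
# Imbrie (2016), Assumption LLA — XY rung: the elementary steps of the β-Hermite domination bound (DENSITY-XY §5.3)

CITATION HEADER (lean-in-tree rule 2026-08-18). J. Z. Imbrie, *On many-body localization for quantum spin chains*,
J. Stat. Phys. **163** (2016) 998–1048, doi 10.1007/s10955-016-1508-x, arXiv:1403.7837 [ImbrieJSP2016], eq. (1.3) (Assumption LLA(ν, C))
and §4.2.1.  External input of the argument these lemmas serve (NOT formalised here, used in the cell's prose as a published black box):
I. Dumitriu, A. Edelman, *Matrix models for beta ensembles*, J. Math. Phys. **43** (2002) 5830–5847, doi 10.1063/1.1507823,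
arXiv:math-ph/0206043, Theorem 2.12 (for every β > 0 the tridiagonal matrix with independent entries `a_i ~ N(0,1)`,
`b_k ~ χ_{kβ}/√2`, i.e. entry density `c_{a,b} · exp(−Σ a_i²/2) · ∏_k b_k^{kβ−1} exp(−b_k²)` with
`c_{a,b} = 2^{n−1} / ((2π)^{n/2} ∏_{k=1}^{n−1} Γ(kβ/2))`, has ordered eigenvalue density `n! · c_H^β · |Δ(λ)|^β · exp(−Σ λ_i²/2)`,
`c_H^β = (2π)^{−n/2} ∏_{j=1}^{n} Γ(1+β/2)/Γ(1+jβ/2)`).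

WHAT IS PROVED (lemmas of the audit cell `pub-imbrie`, NOT statements of the paper; cell file `b2b-imbrie-2/DENSITY-XY.md` §5.3, Theorem 5.4).
For the free-fermion (XY) sibling of Imbrie's chain the n-site block is a Jacobi matrix `Jac(h, γ|u|)` with random fields `|h_i| ≤ 1` and random
couplings `γ|u_j| ∈ (0, γ]`, joint density `≤ ρ₀ⁿ(2ρ₀)^{n−1} γ^{−(n−1)}`.  Theorem 5.4 of the cell bounds the joint density of its levels, hence every
LLA-type pattern probability `P(|ε·λ − E| < δ) ≤ 4nρ₀ (200 ρ₀² max(ln(6/γ),2))^{n−1} δ`, by DOMINATING the entry law pointwise by the β-Hermite entry law with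
`β = 2/(n·max(ln(6/γ),2)) ≤ 1/(n−1)` and pushing the domination forward to the spectrum.  This file kernel-checks every elementary step of that chain:
* `betaHermite_coupling_dominated` — on `0 < b ≤ γ ≤ 1`, for every exponent `κ ≤ 1` (κ = kβ): `γ⁻¹ ≤ e · γ^{−κ} · (b^{κ−1} e^{−b²})`
  (the flat coupling density is dominated by the χ_κ-shape density, constant `e γ^{−κ}`; this is where `β ≤ 1/(n−1)` is needed);
* `betaHermite_field_dominated` — on `|a| ≤ 1`: `1 ≤ e^{1/2} · e^{−a²/2}`;
* `map_le_smul_map_of_le_smul` — domination `μ ≤ κ • ν` of measures is preserved by push-forward (here: (entries) ↦ (ordered spectrum));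
* `betaHermite_constant_ratio` — the constant algebra `n! c_H^β / c_{a,b} = n Γ(1+β/2)ⁿ / (β^{n−1} Γ(1+nβ/2))` (with `P` standing for `(2π)^{n/2}`,
  any `P ≠ 0`), via `Γ(kβ/2) = (2/(kβ)) Γ(1+kβ/2)` and `∏_{k<n} (k+1) = n!`;
* `betaHermite_beta_choice` — for `n ≥ 2`, `L ≥ 2`, `β = 2/(nL)`: `β ≤ 1/(n−1)` and `β^{−(n−1)} exp(β n(n−1)L/2) = (nL/2)^{n−1} e^{n−1}`;
* `succ_pow_div_factorial_le_exp_pow` — `(m+1)^m / m! ≤ e^m` (i.e. `n^{n−1}/(n−1)! ≤ e^{n−1}`), used to turn the chamber-slab volume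
  `2·6^{n−1}δ/(n−1)!` times `n^{n−1}` into a `Cⁿ δ` bound.
STATUS: elementary real analysis / measure theory; it says NOTHING about whether LLA holds for the chain (1.1) (OPEN, pub-imbrie LLA.md) — the
XY-rung theorem it serves is prose-proved in the cell folder modulo the published Dumitriu–Edelman theorem.  No `sorry`, no new axioms, no definitions.
-/

namespace Literature.MathematicalPhysics.QuantumLattice.Imbrie2016

open _root_.MeasureTheory

/-- Coupling-entry domination: for `0 < b ≤ γ ≤ 1` and `κ ≤ 1`, the flat density `γ⁻¹` on `(0, γ]` is bounded by `e γ^{−κ}` times the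
χ_κ-shape density `b^{κ−1} e^{−b²}` (normalising constants aside).  [cite: ImbrieJSP2016, §4.2.1; Dumitriu–Edelman 2002, Thm 2.12] -/
theorem betaHermite_coupling_dominated (γ b κ : ℝ) (hb : 0 < b) (hbγ : b ≤ γ) (hγ : γ ≤ 1) (hκ : κ ≤ 1) :
    γ⁻¹ ≤ Real.exp 1 * γ ^ (-κ) * (b ^ (κ - 1) * Real.exp (-b ^ 2)) := by
  have hγpos : 0 < γ := lt_of_lt_of_le hb hbγ
  have h1 : γ ^ (κ - 1) ≤ b ^ (κ - 1) := Real.rpow_le_rpow_of_nonpos hb hbγ (by linarith)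
  have hb1 : b ≤ 1 := le_trans hbγ hγ
  have h2 : Real.exp (-1) ≤ Real.exp (-b ^ 2) := by
    apply Real.exp_le_exp.mpr
    nlinarith
  have key : γ⁻¹ = Real.exp 1 * γ ^ (-κ) * (γ ^ (κ - 1) * Real.exp (-1)) := by
    have hsplit : γ ^ (-κ) * γ ^ (κ - 1) = γ ^ (-1 : ℝ) := by
      rw [← Real.rpow_add hγpos]; congr 1; ring
    have hexp : Real.exp 1 * Real.exp (-1) = 1 := by
      rw [← Real.exp_add]; norm_num
    calc γ⁻¹ = γ ^ (-1 : ℝ) := (Real.rpow_neg_one γ).symm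
      _ = (γ ^ (-κ) * γ ^ (κ - 1)) * (Real.exp 1 * Real.exp (-1)) := by rw [hsplit, hexp, mul_one]
      _ = Real.exp 1 * γ ^ (-κ) * (γ ^ (κ - 1) * Real.exp (-1)) := by ring
  rw [key]
  have hA : 0 ≤ Real.exp 1 * γ ^ (-κ) := mul_nonneg (Real.exp_pos 1).le (Real.rpow_nonneg hγpos.le _)
  exact mul_le_mul_of_nonneg_left
    (mul_le_mul h1 h2 (Real.exp_pos _).le (Real.rpow_nonneg hb.le _)) hA

/-- Field-entry domination: on `|a| ≤ 1` the flat density `1` is at most `e^{1/2}` times the standard Gaussian shape `e^{−a²/2}`.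
[cite: ImbrieJSP2016, §4.2.1] -/
theorem betaHermite_field_dominated (a : ℝ) (ha : |a| ≤ 1) :
    (1 : ℝ) ≤ Real.exp (1 / 2) * Real.exp (-a ^ 2 / 2) := by
  have hsq : a ^ 2 ≤ 1 := by
    have h0 : 0 ≤ |a| := abs_nonneg a
    have : |a| ^ 2 ≤ 1 := by nlinarith
    simpa [sq_abs] using this
  rw [← Real.exp_add]
  have : (0 : ℝ) ≤ 1 / 2 + -a ^ 2 / 2 := by linarith
  simpa using Real.one_le_exp this

/-- Push-forward preserves domination of measures: if `μ ≤ κ • ν` then `μ ∘ f⁻¹ ≤ κ • (ν ∘ f⁻¹)` for measurable `f`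
(applied in the cell with `f` = (Jacobi entries) ↦ (ordered spectrum)).  [folklore] -/
theorem map_le_smul_map_of_le_smul {α β : Type*} [MeasurableSpace α] [MeasurableSpace β]
    {μ ν : Measure α} {κ : ENNReal} {f : α → β} (hf : Measurable f) (h : μ ≤ κ • ν) :
    μ.map f ≤ κ • ν.map f := by
  calc μ.map f ≤ (κ • ν).map f := Measure.map_mono h hf
    _ = κ • ν.map f := Measure.map_smul κ ν f

/-- `Γ(s) = Γ(s+1)/s` in the form used for the χ normalisations: `Γ(kβ/2) = (2/(kβ)) · Γ(1 + kβ/2)`.  [folklore] -/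
theorem Gamma_half_mul_eq (t : ℝ) (ht : 0 < t) :
    Real.Gamma (t / 2) = 2 / t * Real.Gamma (1 + t / 2) := by
  have hne : t / 2 ≠ 0 := by positivity
  have h := Real.Gamma_add_one hne
  rw [add_comm] at h
  rw [h]
  field_simp

/-- The constant algebra of DENSITY-XY Thm 5.4(a): with `P` standing for `(2π)^{n/2}` (any `P ≠ 0`),
`n! · c_H^β / c_{a,b} = n · Γ(1+β/2)ⁿ / (β^{n−1} Γ(1+nβ/2))`, where `c_H^β = P⁻¹ ∏_{j<n} Γ(1+β/2)/Γ(1+(j+1)β/2)` and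
`c_{a,b} = 2^{n−1} / (P · ∏_{k<n−1} Γ((k+1)β/2))` (stated for `n = m+1`).  [cite: ImbrieJSP2016, §4.2.1; Dumitriu–Edelman 2002, Thm 2.12] -/
theorem betaHermite_constant_ratio (β P : ℝ) (hβ : 0 < β) (hP : P ≠ 0) (m : ℕ) :
    ((m + 1).factorial : ℝ) *
        (P⁻¹ * ∏ j ∈ Finset.range (m + 1), (Real.Gamma (1 + β / 2) / Real.Gamma (1 + (j + 1) * β / 2))) /
        ((2 : ℝ) ^ m / (P * ∏ k ∈ Finset.range m, Real.Gamma ((k + 1) * β / 2)))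
      = (m + 1) * Real.Gamma (1 + β / 2) ^ (m + 1) / (β ^ m * Real.Gamma (1 + (m + 1) * β / 2)) := by
  -- abbreviations
  set G : ℕ → ℝ := fun k => Real.Gamma (1 + (k + 1) * β / 2) with hG
  have hGpos : ∀ k, 0 < G k := by
    intro k; simp only [hG]; apply Real.Gamma_pos_of_pos; positivity
  have hGne : ∀ k, G k ≠ 0 := fun k => (hGpos k).ne'
  -- rewrite Γ((k+1)β/2) = (2/((k+1)β)) Γ(1+(k+1)β/2)
  have hlow : ∀ k : ℕ, Real.Gamma ((k + 1) * β / 2) = 2 / ((k + 1) * β) * G k := by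
    intro k
    have := Gamma_half_mul_eq ((k + 1) * β) (by positivity)
    simpa [hG] using this
  have hprod_low : ∏ k ∈ Finset.range m, Real.Gamma ((k + 1) * β / 2)
      = (∏ k ∈ Finset.range m, (2 / ((k + 1) * β))) * ∏ k ∈ Finset.range m, G k := by
    rw [← Finset.prod_mul_distrib]
    exact Finset.prod_congr rfl (fun k _ => hlow k)
  -- ∏_{k<m} 2/((k+1)β) = 2^m / (β^m m!)
  have hprod_coef : ∏ k ∈ Finset.range m, (2 / ((k + 1 : ℝ) * β)) = 2 ^ m / (β ^ m * (m.factorial : ℝ)) := by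
    have hfac : ((m.factorial : ℕ) : ℝ) = ∏ k ∈ Finset.range m, ((k : ℝ) + 1) := by
      rw [← Finset.prod_range_add_one_eq_factorial]; push_cast; rfl
    rw [hfac, Finset.prod_div_distrib, Finset.prod_const, Finset.card_range, Finset.prod_mul_distrib,
      Finset.prod_const, Finset.card_range]
    ring
  -- ∏_{j<m+1} Γ(1+β/2)/G j = Γ(1+β/2)^(m+1) / ((∏_{j<m} G j) * G m)
  have hprod_top : ∏ j ∈ Finset.range (m + 1), (Real.Gamma (1 + β / 2) / Real.Gamma (1 + (j + 1) * β / 2))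
      = Real.Gamma (1 + β / 2) ^ (m + 1) / ((∏ j ∈ Finset.range m, G j) * G m) := by
    rw [Finset.prod_div_distrib, Finset.prod_const, Finset.card_range]
    congr 1
    rw [Finset.prod_range_succ]
  have hPG : (∏ j ∈ Finset.range m, G j) ≠ 0 := Finset.prod_ne_zero_iff.mpr (fun k _ => hGne k)
  have hGm : G m = Real.Gamma (1 + (m + 1) * β / 2) := by simp [hG]
  rw [hprod_top, hprod_low, hprod_coef, Nat.factorial_succ]
  push_cast
  rw [← hGm]
  have hfne : (m.factorial : ℝ) ≠ 0 := by exact_mod_cast m.factorial_ne_zero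
  have hβm : β ^ m ≠ 0 := pow_ne_zero _ hβ.ne'
  have h2m : (2 : ℝ) ^ m ≠ 0 := pow_ne_zero _ two_ne_zero
  field_simp

/-- The choice of β in DENSITY-XY Thm 5.4(b): for `n ≥ 2` and `L ≥ 2` (L = max(ln(6/γ), 2)), `β := 2/(nL)` is admissible
(`β ≤ 1/(n−1)`, so every χ-exponent `kβ − 1 ≤ 0`) and `β^{−(n−1)} · exp(β·n(n−1)L/2) = (nL/2)^{n−1} e^{n−1}`.  [cite: ImbrieJSP2016, §4.2.1] -/
theorem betaHermite_beta_choice (n : ℕ) (L : ℝ) (hn : 2 ≤ n) (hL : 2 ≤ L) :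
    2 / ((n : ℝ) * L) ≤ 1 / ((n : ℝ) - 1) ∧ 0 < 2 / ((n : ℝ) * L) ∧
      ((2 / ((n : ℝ) * L)) ^ (n - 1))⁻¹ * Real.exp (2 / ((n : ℝ) * L) * ((n : ℝ) * ((n : ℝ) - 1) * L / 2))
        = ((n : ℝ) * L / 2) ^ (n - 1) * Real.exp ((n : ℝ) - 1) := by
  have hn' : (2 : ℝ) ≤ n := by exact_mod_cast hn
  have hnpos : (0 : ℝ) < n := by linarith
  have hLpos : 0 < L := by linarith
  refine ⟨?_, by positivity, ?_⟩
  · rw [div_le_div_iff₀ (by positivity) (by linarith)]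
    nlinarith
  · have harg : 2 / ((n : ℝ) * L) * ((n : ℝ) * ((n : ℝ) - 1) * L / 2) = (n : ℝ) - 1 := by
      field_simp
    rw [harg, ← inv_pow, inv_div]

/-- `(m+1)^m / m! ≤ e^m`, i.e. `n^{n−1}/(n−1)! ≤ e^{n−1}` for `n = m+1 ≥ 1` (induction with `(1 + 1/(m+1))^{m+1} ≤ e`).
Used in DENSITY-XY Thm 5.4(c).  [folklore] -/
theorem succ_pow_div_factorial_le_exp_pow (m : ℕ) :
    ((m : ℝ) + 1) ^ m / (m.factorial : ℝ) ≤ Real.exp 1 ^ m := by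
  induction m with
  | zero => simp
  | succ m ih =>
    have hstep : (1 + 1 / ((m : ℝ) + 1)) ^ (m + 1) ≤ Real.exp 1 := by
      have h0 : (0 : ℝ) ≤ 1 + 1 / ((m : ℝ) + 1) := by positivity
      have h1 : 1 + 1 / ((m : ℝ) + 1) ≤ Real.exp (1 / ((m : ℝ) + 1)) := by
        have := Real.add_one_le_exp (1 / ((m : ℝ) + 1)); linarith
      calc (1 + 1 / ((m : ℝ) + 1)) ^ (m + 1) ≤ (Real.exp (1 / ((m : ℝ) + 1))) ^ (m + 1) :=
            pow_le_pow_left₀ h0 h1 (m + 1)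
        _ = Real.exp (((m + 1 : ℕ) : ℝ) * (1 / ((m : ℝ) + 1))) := (Real.exp_nat_mul _ _).symm
        _ = Real.exp 1 := by
            congr 1; push_cast; field_simp
    have hfpos : (0 : ℝ) < (m.factorial : ℝ) := by exact_mod_cast m.factorial_pos
    have hm1 : ((m : ℝ) + 1) ≠ 0 := by positivity
    have hbase : ((m : ℝ) + 1 + 1) = (1 + 1 / ((m : ℝ) + 1)) * ((m : ℝ) + 1) := by
      field_simp
      
    have heq : (((m + 1 : ℕ) : ℝ) + 1) ^ (m + 1) / ((m + 1).factorial : ℝ)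
        = (1 + 1 / ((m : ℝ) + 1)) ^ (m + 1) * (((m : ℝ) + 1) ^ m / (m.factorial : ℝ)) := by
      rw [Nat.factorial_succ]; push_cast
      rw [hbase, mul_pow, pow_succ ((m : ℝ) + 1) m]
      field_simp
      
    rw [heq, pow_succ (Real.exp 1) m, mul_comm (Real.exp 1 ^ m) (Real.exp 1)]
    exact mul_le_mul hstep ih (by positivity) (Real.exp_pos 1).le

end Literature.MathematicalPhysics.QuantumLattice.Imbrie2016
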